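import Summits.BirchSwinnertonDyer.BirchSwinnertonDyer.Theorems.ClassRecordThreeCartanOnePlaceDegreeLawAtThreeOrbitFactorCovering
import Summits.BirchSwinnertonDyer.BirchSwinnertonDyer.Theorems.ClassRecordThreeEulerHalvesAtThreeEichlerShimuraTorsionCountN
import Summits.BirchSwinnertonDyer.BirchSwinnertonDyer.Theorems.ClassRecordThreeEulerHalvesAtThreeCartanCoverPrintClausesQuotientSurface
import Literature.Geometry.Manifold.QuotientMaps
import HarnessLib

/-!
# Crux NUM `CartanOnePlaceDegreeLawAtThree` (item 24801), line `petarea` rev 6, cite conjunct 4 (torsion-null lifting at division algebras):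
# THE UPSTAIRS HALF OF THE KERNEL-COVER TOWER — the compact Riemann surface `Γ'∖ℍ` of the torsion-free level `Γ' ≤ ker ψ` with the finite,
# effective, holomorphic action of `ι(O¹)` — AND CONJUNCT 4 AS A THEOREM

Seat `bsd-stepL-tam3-p1` g32 (LEAD of crux 24801; `--supports stmt-BirchSwinnertonDyer-24801 --as helper`). Sequel of `…OrbitFactorCovering` (p763877: the
downstairs covering `M/H → M/G` and the assembly `EichlerShimuraTower.torsLift_of_holomorphicQuotientDatum`), of bsd-idea-10 g25's parts M
(`EichlerShimuraLevelM.torsLift_of_tower`) and N (`EichlerShimuraLevelN.exists_torsionFree_level_subgroup_le_ker`, `eq_zero_of_smul_eq_smul`), and of the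
g29 brick `CartanCover.PrintClauses.isManifold_orbitQuotient` (`Γ∖ℍ` is a Riemann surface for `Γ` free and properly discontinuous).

* §1 `exists_holomorphicQuotientDatum` — **BRICK (T-b)**: for `B` a division algebra, `ι` injective, `n ≠ 0` and `ψ : Γ = ι(O¹) → ZMod n` additive and
  torsion-null, the hypothesis `datum` of `torsLift_of_holomorphicQuotientDatum` HOLDS: `M = Γ'∖ℍ` for part N's torsion-free normal cocompact level
  `Γ' ≤ ker ψ` (a compact connected `T₂` Riemann surface: Mathlib's charted space of a free properly discontinuous quotient + the tree's
  `QuotientManifold.isManifold`; compact because a compact set meets every orbit; connected as a quotient of `ℍ`), on which `Γ` acts by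
  `γ·[z] = [γz]` (`Γ'` is normal) — holomorphically, by DESCENT THROUGH THE FREE COVER `ℍ → Γ'∖ℍ` (`QuotientManifold.mdifferentiable_comp_mk_iff`:
  `[z] ↦ [γz]` composed with the projection is the holomorphic `z ↦ [γz]`) — and `G = Γ ∕ K₀`, `K₀` the kernel of that action (`⊇ Γ'`, so `G` is
  finite), acting effectively by construction (`MulAction.compHom` along the injective `QuotientGroup.kerLift`); `σ = Γ ↠ G`, `p = ℍ ↠ Γ'∖ℍ` the
  projections, `p(γz) = σ(γ)p(z)` by definition; and if `σ(γ)` fixes `[z]` then `γz = δz` for some `δ ∈ Γ' ≤ ker ψ`, so `ψ γ = 0` by part N's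
  `eq_zero_of_smul_eq_smul` (this is where torsion-nullity of `ψ` is consumed).
* §2 **`torsLift_holds`** — CONJUNCT 4 OF `stub_printInputsFive` (`Lines/petarea.lean` rev 6), i.e. the hypothesis `htors` of part K's
  `EichlerShimuraLevelK.parabolicCochain_modLift_of_torsLift`, VERBATIM, as a theorem (§1 + `torsLift_of_holomorphicQuotientData`); and
  **`parabolicCochain_modLift_holds : Literature.NumberTheory.Automorphic.parabolicCochain_modLift`** — the print fact (SIGᶜ-lift)(ii) itself
  (split half: part J ∕ K's `parabolicCochain_modLift_split`; division half: this file), discharging that named fact of the Literature layer.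

Theorems only: no definition, no instance, no notation, no named fact, no `sorry`. After this file the cite stub of line `petarea` has FOUR print
conjuncts ((M), (KTYPE), Deligne–Serre 6.1, (JLᶜ)). Nothing about NUM, (M), (KTYPE), (PET) or any curve is proved; no summit statement is proved;
BSD is proved for no curve.

## References
* G. Shimura, *Introduction to the Arithmetic Theory of Automorphic Functions* (1971), §1.5 (the quotient `Γ∖ℍ` as a Riemann surface), §8.2 (8.2.6)
  p. 232 (parabolic cochains), §9.2 p. 246 (`Γ∖ℍ` compact for a division algebra). [ShimuraIATAF1971]
* R. Miranda, *Algebraic Curves and Riemann Surfaces*, GSM 5 (1995), Ch. III §3 Thm. 3.4 (finite group quotients of Riemann surfaces). [Miranda1995]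
* A. Hatcher, *Algebraic Topology* (2002), §1.3 Prop. 1.40 p. 72. [HatcherAT2002]
* H. M. Farkas, I. Kra, *Riemann Surfaces*, GTM 71, 2nd ed. (1992), IV.5 (`ℍ∕Γ` for fixed-point-free `Γ`), I.2.5. [FarkasKra1992]
-/

set_option linter.dupNamespace false
set_option autoImplicit false

noncomputable section

open scoped Manifold ContDiff Topology MatrixGroups
open Function Set MulAction Topology

namespace Summit.BirchSwinnertonDyer.BirchSwinnertonDyer.Theorems.EichlerShimuraTower

open Literature.Geometry.Kaehler Literature.Geometry.Kaehler.RiemannSurface Literature.Geometry.Manifold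
open Literature.NumberTheory.Automorphic
open Summit.BirchSwinnertonDyer.BirchSwinnertonDyer.Theorems.CartanCover.PrintClauses

/-! ## §1 Brick (T-b): the finite holomorphic quotient datum of `ι(O¹)` on `Γ'∖ℍ` -/

/-- **BRICK (T-b): THE FINITE HOLOMORPHIC QUOTIENT DATUM.** For `B` a quaternion division algebra over `ℚ`, `O` an order, `ι : B →ₐ[ℚ] M₂(ℝ)` injective,
`n ≠ 0` and `ψ : ι(O¹) → ZMod n` additive and vanishing on the elements of finite order: the compact connected Riemann surface `M = Γ'∖ℍ` (`Γ'` the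
torsion-free normal cocompact level of finite index inside `ker ψ`), the finite group `G = ι(O¹) ∕ K₀` (`K₀` the kernel of `ι(O¹)` acting on `M`) acting
holomorphically and effectively on `M`, the projections `σ : ι(O¹) ↠ G`, `p : ℍ ↠ M` with `p(γz) = σ(γ)p(z)`, and: `σ(γ)` fixes a point of `M` only if
`ψ γ = 0`. [cite: ShimuraIATAF1971, §1.5 and §9.2 p. 246] [cite: FarkasKra1992, IV.5] [cite: Miranda1995, Chapter III Theorem 3.4] -/
theorem exists_holomorphicQuotientDatum (B : Type) [Ring B] [Algebra ℚ B] [IsQuaternionAlgebra ℚ B] (O : Submodule ℤ B)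
    (hO : Brandt.IsOrder B O) (ι : B →ₐ[ℚ] Matrix (Fin 2) (Fin 2) ℝ) (hι : Function.Injective ι) (hdiv : ∀ x : B, x ≠ 0 → IsUnit x)
    (n : ℕ) (hn : n ≠ 0) (ψ : normOneUnits ι hO → ZMod n)
    (hadd : ∀ γ δ : normOneUnits ι hO, ψ (γ * δ) = ψ γ + ψ δ)
    (htor : ∀ γ : normOneUnits ι hO, IsOfFinOrder γ → ψ γ = 0) :
    ∃ (M : Type) (_ : TopologicalSpace M) (_ : ChartedSpace ℂ M) (_ : IsManifold 𝓘(ℂ, ℂ) ω M)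
        (_ : T2Space M) (_ : CompactSpace M) (_ : ConnectedSpace M)
        (G : Type) (_ : Group G) (_ : Finite G) (_ : MulAction G M) (_ : HolomorphicSMul G M) (_ : FaithfulSMul G M)
        (σ : normOneUnits ι hO →* G) (p : C(UpperHalfPlane, M)),
        Function.Surjective σ ∧ Function.Surjective p ∧
          (∀ (γ : normOneUnits ι hO) (z : UpperHalfPlane), p (γ • z) = σ γ • p z) ∧
          ∀ (γ : normOneUnits ι hO) (z : UpperHalfPlane), σ γ • p z = p z → ψ γ = 0 := by
  classical
  obtain ⟨Γ', hle, hψ0, hN, hfi, hpd, htf, K, hK, hcov⟩ :=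
    EichlerShimuraLevelN.exists_torsionFree_level_subgroup_le_ker ι hO hι hdiv hn ψ hadd
  haveI := hpd
  haveI : Γ'.HasDetOne := ⟨fun {g} hg => Subgroup.HasDetOne.det_eq (hle hg)⟩
  haveI : IsCancelSMul Γ' UpperHalfPlane := isCancelSMul_of_torsionFree Γ' htf
  -- the upstairs Riemann surface `M = Γ'∖ℍ`
  haveI hMfd : IsManifold 𝓘(ℂ, ℂ) ω (orbitRel.Quotient Γ' UpperHalfPlane) := isManifold_orbitQuotient Γ'
  haveI : CompactSpace (orbitRel.Quotient Γ' UpperHalfPlane) := by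
    refine ⟨?_⟩
    have hsurj : (Quotient.mk (orbitRel Γ' UpperHalfPlane)) '' K = Set.univ := by
      refine Set.eq_univ_of_forall fun y => ?_
      induction y using Quotient.inductionOn with
      | h z =>
        obtain ⟨γ, hγ, hγz⟩ := hcov z
        exact ⟨γ • z, hγz, Quotient.sound ⟨⟨γ, hγ⟩, rfl⟩⟩
    rw [← hsurj]
    exact hK.image continuous_quot_mk
  haveI : ConnectedSpace (orbitRel.Quotient Γ' UpperHalfPlane) := Quotient.instConnectedSpace
  have hsmooth : ∀ g : Γ', ContMDiff 𝓘(ℂ, ℂ) 𝓘(ℂ, ℂ) ω (fun z : UpperHalfPlane => g • z) := contMDiff_subgroup_smul Γ'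
  -- the action of `Γ = ι(O¹)` on `M`: `γ·[z] = [γz]` (`Γ'` is normal in `Γ`)
  have hconj : ∀ (γ : normOneUnits ι hO) (δ : Γ'), (γ : GL (Fin 2) ℝ) * δ * (γ : GL (Fin 2) ℝ)⁻¹ ∈ Γ' := by
    intro γ δ
    have hδ : (⟨(δ : GL (Fin 2) ℝ), hle δ.2⟩ : normOneUnits ι hO) ∈ Γ'.subgroupOf (normOneUnits ι hO) :=
      Subgroup.mem_subgroupOf.mpr δ.2
    have h := hN.conj_mem _ hδ γ
    exact Subgroup.mem_subgroupOf.mp h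
  have hcompat : ∀ (γ : normOneUnits ι hO) (z₁ z₂ : UpperHalfPlane), (orbitRel Γ' UpperHalfPlane) z₁ z₂ →
      (orbitRel Γ' UpperHalfPlane) ((γ : GL (Fin 2) ℝ) • z₁) ((γ : GL (Fin 2) ℝ) • z₂) := by
    intro γ z₁ z₂ h
    obtain ⟨δ, hδ⟩ := orbitRel_apply.mp h
    refine orbitRel_apply.mpr ⟨⟨_, hconj γ δ⟩, ?_⟩
    change ((γ : GL (Fin 2) ℝ) * δ * (γ : GL (Fin 2) ℝ)⁻¹) • (γ : GL (Fin 2) ℝ) • z₂ = (γ : GL (Fin 2) ℝ) • z₁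
    rw [← mul_smul, inv_mul_cancel_right, mul_smul]
    exact congrArg _ hδ
  let act : normOneUnits ι hO → orbitRel.Quotient Γ' UpperHalfPlane → orbitRel.Quotient Γ' UpperHalfPlane := fun γ =>
    Quotient.map' (fun z : UpperHalfPlane => (γ : GL (Fin 2) ℝ) • z) (fun z₁ z₂ h => hcompat γ z₁ z₂ h)
  have act_mk : ∀ (γ : normOneUnits ι hO) (z : UpperHalfPlane),
      act γ (Quotient.mk _ z) = Quotient.mk _ ((γ : GL (Fin 2) ℝ) • z) := fun _ _ => rfl
  letI instΓ : MulAction (normOneUnits ι hO) (orbitRel.Quotient Γ' UpperHalfPlane) :=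
    { smul := act
      one_smul := fun y => by
        induction y using Quotient.inductionOn with
        | h z => change act 1 (Quotient.mk _ z) = _; rw [act_mk]; simp
      mul_smul := fun γ γ' y => by
        induction y using Quotient.inductionOn with
        | h z =>
          change act (γ * γ') (Quotient.mk _ z) = act γ (act γ' (Quotient.mk _ z))
          rw [act_mk, act_mk, act_mk, Subgroup.coe_mul, mul_smul] }
  have smul_mk : ∀ (γ : normOneUnits ι hO) (z : UpperHalfPlane),
      γ • (Quotient.mk (orbitRel Γ' UpperHalfPlane) z) = Quotient.mk _ ((γ : GL (Fin 2) ℝ) • z) := fun _ _ => rfl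
  -- the kernel `K₀` of the action and the finite group `G = Γ ∕ K₀`, acting effectively
  let ρ : normOneUnits ι hO →* Equiv.Perm (orbitRel.Quotient Γ' UpperHalfPlane) :=
    MulAction.toPermHom (normOneUnits ι hO) (orbitRel.Quotient Γ' UpperHalfPlane)
  have hρ : ∀ γ y, ρ γ y = γ • y := fun _ _ => rfl
  have hΓ'K : Γ'.subgroupOf (normOneUnits ι hO) ≤ ρ.ker := by
    intro δ hδ
    rw [MonoidHom.mem_ker]
    ext y
    induction y using Quotient.inductionOn with
    | h z =>
      rw [hρ, smul_mk, Equiv.Perm.coe_one, id_eq]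
      exact Quotient.sound (orbitRel_apply.mpr ⟨⟨(δ : GL (Fin 2) ℝ), Subgroup.mem_subgroupOf.mp hδ⟩, rfl⟩)
  haveI : ρ.ker.FiniteIndex := Subgroup.finiteIndex_of_le hΓ'K
  haveI : Finite (normOneUnits ι hO ⧸ ρ.ker) := Subgroup.finite_quotient_of_finiteIndex
  letI instG : MulAction (normOneUnits ι hO ⧸ ρ.ker) (orbitRel.Quotient Γ' UpperHalfPlane) :=
    MulAction.compHom (orbitRel.Quotient Γ' UpperHalfPlane) (QuotientGroup.kerLift ρ)
  have smulG_mk : ∀ (γ : normOneUnits ι hO) (y : orbitRel.Quotient Γ' UpperHalfPlane),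
      (QuotientGroup.mk γ : normOneUnits ι hO ⧸ ρ.ker) • y = γ • y := by
    intro γ y
    change (QuotientGroup.kerLift ρ (QuotientGroup.mk γ)) y = γ • y
    rw [QuotientGroup.kerLift_mk, hρ]
  haveI : FaithfulSMul (normOneUnits ι hO ⧸ ρ.ker) (orbitRel.Quotient Γ' UpperHalfPlane) := by
    refine ⟨fun {a b} hab => QuotientGroup.kerLift_injective ρ (Equiv.ext fun y => ?_)⟩
    exact hab y
  haveI : HolomorphicSMul (normOneUnits ι hO ⧸ ρ.ker) (orbitRel.Quotient Γ' UpperHalfPlane) := by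
    refine ⟨fun a => ?_⟩
    induction a using QuotientGroup.induction_on with
    | H γ =>
      have hfun : (fun y : orbitRel.Quotient Γ' UpperHalfPlane => (QuotientGroup.mk γ : normOneUnits ι hO ⧸ ρ.ker) • y) =
          fun y => γ • y := funext fun y => smulG_mk γ y
      rw [hfun]
      refine (QuotientManifold.mdifferentiable_comp_mk_iff (G := Γ') (I := 𝓘(ℂ, ℂ)) (n := ω) hsmooth (by simp)).mp ?_
      have hcomp : ((fun y : orbitRel.Quotient Γ' UpperHalfPlane => γ • y) ∘ QuotientManifold.mk (G := Γ')) =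
          QuotientManifold.mk (G := Γ') ∘ fun z : UpperHalfPlane => (γ : GL (Fin 2) ℝ) • z := by
        funext z; exact smul_mk γ z
      rw [hcomp]
      exact ((QuotientManifold.contMDiff_mk hsmooth).comp (contMDiff_subgroup_smul (normOneUnits ι hO) γ)).mdifferentiable (by simp)
  -- the datum
  refine ⟨orbitRel.Quotient Γ' UpperHalfPlane, inferInstance, inferInstance, hMfd, inferInstance, inferInstance, inferInstance,
    normOneUnits ι hO ⧸ ρ.ker, inferInstance, inferInstance, instG, inferInstance, inferInstance,
    QuotientGroup.mk' ρ.ker, ⟨Quotient.mk _, continuous_quot_mk⟩, QuotientGroup.mk'_surjective ρ.ker, Quotient.mk_surjective, ?_, ?_⟩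
  · intro γ z
    change Quotient.mk _ ((γ : GL (Fin 2) ℝ) • z) = (QuotientGroup.mk γ : normOneUnits ι hO ⧸ ρ.ker) • Quotient.mk _ z
    rw [smulG_mk, smul_mk]
  · intro γ z h
    change (QuotientGroup.mk γ : normOneUnits ι hO ⧸ ρ.ker) • Quotient.mk _ z = Quotient.mk _ z at h
    rw [smulG_mk, smul_mk] at h
    obtain ⟨δ, hδ⟩ := orbitRel_apply.mp (Quotient.exact h)
    -- `δ • z = γ • z` with `δ ∈ Γ' ≤ ker ψ`
    let δ' : normOneUnits ι hO := ⟨(δ : GL (Fin 2) ℝ), hle δ.2⟩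
    have hδ' : δ' • z = γ • z := hδ
    exact EichlerShimuraLevelN.eq_zero_of_smul_eq_smul ι hO hι hdiv ψ hadd htor γ δ' (hψ0 δ' δ.2) hδ'

/-! ## §2 Conjunct 4 of `stub_printInputsFive` and the print fact (SIGᶜ-lift)(ii), as theorems -/

/-- **TORSION-NULL LIFTING AT DIVISION ALGEBRAS — conjunct 4 of `stub_printInputsFive` (`Lines/petarea.lean` rev 6), the hypothesis `htors` of
`EichlerShimuraLevelK.parabolicCochain_modLift_of_torsLift`, VERBATIM, PROVED**: for every quaternion division algebra `B/ℚ`, order `O`, injective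
`ι : B →ₐ[ℚ] M₂(ℝ)` and `n ≠ 0`, every additive `ψ : ι(O¹) → ℤ/n` vanishing on the elements of finite order is the reduction of an additive `u : ι(O¹) → ℤ`
(kernel-cover tower: §1 + `torsLift_of_holomorphicQuotientData` + parts M, N; `π₁(Γ∖ℍ)ᵃᵇ ≅ ℤ^{2g}` by the tree's `RiemannSurface.nonempty_abelianization_addEquiv_pi`).
[cite: ShimuraIATAF1971, §8.2 (8.2.6) p. 232 and §9.2 p. 246] [cite: HatcherAT2002, §1.3 Prop. 1.40 p. 72] [cite: FarkasKra1992, I.2.5] -/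
theorem torsLift_holds :
    ∀ (B : Type) [Ring B] [Algebra ℚ B] [IsQuaternionAlgebra ℚ B] (O : Submodule ℤ B) (hO : Brandt.IsOrder B O)
      (ι : B →ₐ[ℚ] Matrix (Fin 2) (Fin 2) ℝ), Function.Injective ι → (∀ x : B, x ≠ 0 → IsUnit x) →
      ∀ (n : ℕ), n ≠ 0 → ∀ ψ : normOneUnits ι hO → ZMod n,
        (∀ γ δ : normOneUnits ι hO, ψ (γ * δ) = ψ γ + ψ δ) →
        (∀ γ : normOneUnits ι hO, IsOfFinOrder γ → ψ γ = 0) →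
        ∃ u : normOneUnits ι hO → ℤ,
          (∀ γ δ : normOneUnits ι hO, u (γ * δ) = u γ + u δ) ∧ ∀ γ : normOneUnits ι hO, (u γ : ZMod n) = ψ γ :=
  torsLift_of_holomorphicQuotientData fun B _ _ _ O hO ι hι hdiv n hn ψ hadd htor =>
    exists_holomorphicQuotientDatum B O hO ι hι hdiv n hn ψ hadd htor

/-- **THE PRINT FACT (SIGᶜ-lift)(ii) `parabolicCochain_modLift` IS A THEOREM** (split half: parts J∕K; division half: `torsLift_holds`).
[cite: ShimuraIATAF1971, §8.2 (8.2.6) p. 232] [cite: Beardon1983, Thm. 10.3.2] -/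
theorem parabolicCochain_modLift_holds : parabolicCochain_modLift :=
  EichlerShimuraLevelK.parabolicCochain_modLift_of_torsLift torsLift_holds

end Summit.BirchSwinnertonDyer.BirchSwinnertonDyer.Theorems.EichlerShimuraTower

end
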